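import Mathlib.Analysis.SpecialFunctions.Pow.Asymptotics
import HarnessLib

/-!
# Barrier tool: the SCALING AUDIT — an inequality between homogeneous quantities of different degrees
# cannot hold on a dilation-invariant class (kill route 2 of cell `ns-claims`, made a reusable lemma)

Barrier catalogue support file for `NavierStokesRegularity` (D-0021), METHOD LEVEL, everything PROVED
(elementary real analysis). Tao's «dimensional analysis» heuristic — «the energy can be used to control a
given quantity only if the scaling exponents match» [cite: Tao2007WhyNSHard, supercriticality paragraph (rescaling `u^{(λ)}`)] —
in the form a refuter can instantiate in five lines: if a class `S` of fields is invariant under a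
one-parameter group of dilations `δ_λ` (`λ > 0`), and two functionals are homogeneous on `S`,
`F(δ_λu) = λ^s F(u)`, `G(δ_λu) = λ^r G(u)`, then an inequality `F(u) ≤ C·G(u)` for ALL `u ∈ S` — with `C`
independent of `u` — forces `s = r` as soon as one `u₀ ∈ S` has `F(u₀) > 0` and `G(u₀)` finite
(`exponent_eq_of_forall_le`); contrapositively (`not_exists_forall_le_of_exponent_ne`), mismatched exponents
refute every such displayed inequality (the cell's kill route 2: «a T-independent bound whose constants depend
on scale-variant norms in an inconsistent combination dies on the dilated family»). Products/powers of
several homogeneous functionals are again homogeneous, so the two-functional form covers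
`F ≤ C G₁^a G₂^b` (degree `a r₁ + b r₂`). Companion of `EnergySupercriticality` (the Navier–Stokes
scaling itself: `Supercritical.stDilation`, energy exponent `−1`).

WHAT THIS IS NOT: not a claim about NS regularity or blow-up; not a claim about any author beyond the typed
locator.
-/

noncomputable section

open Filter Topology Set

namespace Literature.Barriers.NavierStokesRegularity

namespace ScalingAudit

/-- If `λ^d ≤ K` for EVERY `λ > 0` then `d = 0` (for `d > 0` let `λ → ∞`, for `d < 0` let `λ → 0⁺`). [folklore] -/
private theorem eq_zero_of_forall_rpow_le {d K : ℝ} (h : ∀ l : ℝ, 0 < l → l ^ d ≤ K) : d = 0 := by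
  by_contra hd
  rcases lt_or_gt_of_ne hd with hneg | hpos
  · -- `λ → 0⁺`: `λ^d → +∞`
    have ht := tendsto_rpow_neg_nhdsGT_zero hneg
    have hev := (ht.eventually (eventually_gt_atTop K)).and self_mem_nhdsWithin
    obtain ⟨l, hlK, hl0⟩ := hev.exists
    exact absurd (h l hl0) (not_le.2 hlK)
  · -- `λ → ∞`: `λ^d → +∞`
    have ht := tendsto_rpow_atTop hpos
    have hev := (ht.eventually (eventually_gt_atTop K)).and (eventually_gt_atTop 0)
    obtain ⟨l, hlK, hl0⟩ := hev.exists
    exact absurd (h l hl0) (not_le.2 hlK)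

variable {X : Type*}

/-- **SCALING AUDIT (exponents must match).** Let `δ : ℝ → X → X` act on a class `S ⊆ X` (`δ_λ S ⊆ S`
for `λ > 0`) and let `F, G : X → ℝ` be homogeneous on `S` of degrees `s, r`: `F(δ_λ u) = λ^s F(u)`,
`G(δ_λ u) = λ^r G(u)`. If `F u ≤ C·G u` for every `u ∈ S` and some `u₀ ∈ S` has `0 < F u₀`, then `s = r`.
(Along the orbit of `u₀`: `λ^{s−r} ≤ C G(u₀)/F(u₀)` for all `λ > 0`.) Dimensional analysis as a lemma.
[cite: Tao2007WhyNSHard, supercriticality paragraph (rescaling `u^{(λ)}`)] -/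
theorem exponent_eq_of_forall_le {δ : ℝ → X → X} {S : Set X} (hS : ∀ l : ℝ, 0 < l → ∀ u ∈ S, δ l u ∈ S)
    {F G : X → ℝ} {s r : ℝ} (hF : ∀ l : ℝ, 0 < l → ∀ u ∈ S, F (δ l u) = l ^ s * F u)
    (hG : ∀ l : ℝ, 0 < l → ∀ u ∈ S, G (δ l u) = l ^ r * G u) {C : ℝ} (hle : ∀ u ∈ S, F u ≤ C * G u)
    {u₀ : X} (hu₀ : u₀ ∈ S) (hF₀ : 0 < F u₀) : s = r := by
  have key : ∀ l : ℝ, 0 < l → l ^ (s - r) ≤ C * G u₀ / F u₀ := by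
    intro l hl
    have h1 := hle (δ l u₀) (hS l hl u₀ hu₀)
    rw [hF l hl u₀ hu₀, hG l hl u₀ hu₀] at h1
    -- `l^s F u₀ ≤ C l^r G u₀` ⇒ `l^{s-r} ≤ C G u₀ / F u₀`
    have hlr : 0 < l ^ r := Real.rpow_pos_of_pos hl r
    rw [le_div_iff₀ hF₀, Real.rpow_sub hl, div_mul_eq_mul_div, div_le_iff₀ hlr]
    calc l ^ s * F u₀ ≤ C * (l ^ r * G u₀) := h1
      _ = C * G u₀ * l ^ r := by ring
  have := eq_zero_of_forall_rpow_le key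
  linarith

/-- **SCALING AUDIT, refutation form.** With `δ, S, F, G` as above and `s ≠ r`, NO constant `C` makes
`F u ≤ C·G u` hold for all `u ∈ S` (given one `u₀ ∈ S` with `F u₀ > 0`). This is the cell's kill route 2:
a displayed inequality whose two sides scale differently under the (Navier–Stokes or amplitude)
dilation is false on the dilated family of any single admissible field.
[cite: Tao2007WhyNSHard, supercriticality paragraph (rescaling `u^{(λ)}`)] -/
theorem not_exists_forall_le_of_exponent_ne {δ : ℝ → X → X} {S : Set X}
    (hS : ∀ l : ℝ, 0 < l → ∀ u ∈ S, δ l u ∈ S) {F G : X → ℝ} {s r : ℝ}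
    (hF : ∀ l : ℝ, 0 < l → ∀ u ∈ S, F (δ l u) = l ^ s * F u)
    (hG : ∀ l : ℝ, 0 < l → ∀ u ∈ S, G (δ l u) = l ^ r * G u) (hsr : s ≠ r)
    {u₀ : X} (hu₀ : u₀ ∈ S) (hF₀ : 0 < F u₀) :
    ¬ ∃ C : ℝ, ∀ u ∈ S, F u ≤ C * G u := by
  rintro ⟨C, hC⟩
  exact hsr (exponent_eq_of_forall_le hS hF hG hC hu₀ hF₀)

/-- **Amplitude scaling** (the commonest instance): on a real vector space take `δ_λ u = λ • u` and
`S` closed under positive multiples; if `F(λu) = λ^s F(u)`, `G(λu) = λ^r G(u)` with `s ≠ r`, then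
`F ≤ C G` fails on `S` (e.g. `‖∇u‖₁₆ ≤ ‖∇u‖₂^{1/8}‖∇u‖_∞^{5/4}`: degrees `1 ≠ 11/8`, cell row C05c).
[cite: Tao2007WhyNSHard, supercriticality paragraph (rescaling `u^{(λ)}`)] -/
theorem not_exists_forall_le_of_amplitude_exponent_ne {V : Type*} [AddCommGroup V] [Module ℝ V]
    {S : Set V} (hS : ∀ l : ℝ, 0 < l → ∀ u ∈ S, l • u ∈ S) {F G : V → ℝ} {s r : ℝ}
    (hF : ∀ l : ℝ, 0 < l → ∀ u ∈ S, F (l • u) = l ^ s * F u)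
    (hG : ∀ l : ℝ, 0 < l → ∀ u ∈ S, G (l • u) = l ^ r * G u) (hsr : s ≠ r)
    {u₀ : V} (hu₀ : u₀ ∈ S) (hF₀ : 0 < F u₀) :
    ¬ ∃ C : ℝ, ∀ u ∈ S, F u ≤ C * G u :=
  not_exists_forall_le_of_exponent_ne (δ := fun l u => l • u) hS hF hG hsr hu₀ hF₀

/-- **Products of powers are homogeneous**: if `G₁, G₂ ≥ 0` on `S` are homogeneous of degrees `r₁, r₂`,
then `u ↦ G₁(u)^a · G₂(u)^b` is homogeneous of degree `a r₁ + b r₂` (real exponents). [folklore] -/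
private theorem homogeneous_rpow_mul_rpow {δ : ℝ → X → X} {S : Set X} {G₁ G₂ : X → ℝ} {r₁ r₂ a b : ℝ}
    (hG₁ : ∀ l : ℝ, 0 < l → ∀ u ∈ S, G₁ (δ l u) = l ^ r₁ * G₁ u)
    (hG₂ : ∀ l : ℝ, 0 < l → ∀ u ∈ S, G₂ (δ l u) = l ^ r₂ * G₂ u)
    (h₁ : ∀ u ∈ S, 0 ≤ G₁ u) (h₂ : ∀ u ∈ S, 0 ≤ G₂ u) :
    ∀ l : ℝ, 0 < l → ∀ u ∈ S,
      G₁ (δ l u) ^ a * G₂ (δ l u) ^ b = l ^ (a * r₁ + b * r₂) * (G₁ u ^ a * G₂ u ^ b) := by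
  intro l hl u hu
  rw [hG₁ l hl u hu, hG₂ l hl u hu, Real.mul_rpow (Real.rpow_nonneg hl.le _) (h₁ u hu),
    Real.mul_rpow (Real.rpow_nonneg hl.le _) (h₂ u hu), ← Real.rpow_mul hl.le, ← Real.rpow_mul hl.le,
    Real.rpow_add hl]
  ring_nf

/-- **SCALING AUDIT for interpolation-type displays `F ≤ C·G₁^a·G₂^b`.** If `F` has degree `s`, `G₁, G₂ ≥ 0`
have degrees `r₁, r₂` and `s ≠ a r₁ + b r₂`, no constant `C` makes `F u ≤ C·G₁(u)^a·G₂(u)^b` hold on the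
dilation-invariant class `S` (given one `u₀ ∈ S` with `F u₀ > 0`). The form refuters meet most often
(Gagliardo–Nirenberg-shaped claims with wrong exponents, «‖·‖_X ≤ ‖·‖_Y^θ‖·‖_Z^{1−θ}» displays).
[cite: Tao2007WhyNSHard, supercriticality paragraph (rescaling `u^{(λ)}`)] -/
theorem not_exists_forall_le_rpow_mul_rpow_of_exponent_ne {δ : ℝ → X → X} {S : Set X}
    (hS : ∀ l : ℝ, 0 < l → ∀ u ∈ S, δ l u ∈ S) {F G₁ G₂ : X → ℝ} {s r₁ r₂ a b : ℝ}
    (hF : ∀ l : ℝ, 0 < l → ∀ u ∈ S, F (δ l u) = l ^ s * F u)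
    (hG₁ : ∀ l : ℝ, 0 < l → ∀ u ∈ S, G₁ (δ l u) = l ^ r₁ * G₁ u)
    (hG₂ : ∀ l : ℝ, 0 < l → ∀ u ∈ S, G₂ (δ l u) = l ^ r₂ * G₂ u)
    (h₁ : ∀ u ∈ S, 0 ≤ G₁ u) (h₂ : ∀ u ∈ S, 0 ≤ G₂ u) (hne : s ≠ a * r₁ + b * r₂)
    {u₀ : X} (hu₀ : u₀ ∈ S) (hF₀ : 0 < F u₀) :
    ¬ ∃ C : ℝ, ∀ u ∈ S, F u ≤ C * (G₁ u ^ a * G₂ u ^ b) :=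
  not_exists_forall_le_of_exponent_ne (G := fun u => G₁ u ^ a * G₂ u ^ b) hS hF
    (homogeneous_rpow_mul_rpow hG₁ hG₂ h₁ h₂) hne hu₀ hF₀

/-! ### One-sided dilation families: the CONCENTRATION audit (`λ ≥ 1`) and the SPREADING audit (`0 < λ ≤ 1`)

On a bounded domain (Dirichlet/no-slip classes), in a weighted space, or on a class that is only closed
under shrinking supports, the full dilation GROUP does not act — but the concentration SEMIGROUP
`u ↦ u(λ·)`, `λ ≥ 1`, does act on the smooth fields supported in a fixed ball inside the domain (cell
`ns-claims`, row C128: an interpolation display `‖(u·∇)u‖_{L²(Ω)} ≤ C‖u‖_{H¹}‖u‖_{H²}^{1/2}‖u‖_{L²}^{1/2}`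
asserted for all `u ∈ H²(Ω)`, whose left side concentrates like `λ^{-1/2}` while the right side is
`O(λ^{-1})`). Dually, on `ℝ³` «without a Poincaré constant» spreading `λ → 0⁺` is the test. For one-sided
families exact homogeneity is more than is needed and, for INHOMOGENEOUS norms (`‖·‖_{H¹}² = ‖·‖² + ‖∇·‖²`),
more than is true: it suffices that the small side is LOWER-homogeneous, `λ^s F(u) ≤ F(δ_λ u)`, and the
large side UPPER-homogeneous, `G(δ_λ u) ≤ λ^r G(u)`, along the family; sums, products and nonnegative
powers of upper-homogeneous nonnegative functionals are upper-homogeneous (`upperHomogeneous_add/_mul/_rpow`,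
degree of a sum = the `max` for `λ ≥ 1`), which is how `‖u‖_{H¹}`, `‖u‖_{H²}^{1/2}` are handled.
[cite: Tao2007WhyNSHard, supercriticality paragraph (rescaling `u^{(λ)}`)] -/

/-- If `λ^d ≤ K` for every `λ ≥ 1` then `d ≤ 0` (else `λ^d → ∞`). [folklore] -/
private theorem nonpos_of_forall_one_le_rpow_le {d K : ℝ} (h : ∀ l : ℝ, 1 ≤ l → l ^ d ≤ K) : d ≤ 0 := by
  by_contra hd
  push Not at hd
  have ht := tendsto_rpow_atTop hd
  obtain ⟨l, hlK, hl1⟩ := ((ht.eventually (eventually_gt_atTop K)).and (eventually_ge_atTop 1)).exists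
  exact absurd (h l hl1) (not_le.2 hlK)

/-- If `λ^d ≤ K` for every `0 < λ ≤ 1` then `0 ≤ d` (else `λ^d → ∞` as `λ → 0⁺`). [folklore] -/
private theorem nonneg_of_forall_le_one_rpow_le {d K : ℝ} (h : ∀ l : ℝ, 0 < l → l ≤ 1 → l ^ d ≤ K) :
    0 ≤ d := by
  by_contra hd
  push Not at hd
  have ht := tendsto_rpow_neg_nhdsGT_zero hd
  obtain ⟨l, hlK, hl⟩ := ((ht.eventually (eventually_gt_atTop K)).and (Ioc_mem_nhdsGT zero_lt_one)).exists
  exact absurd (h l hl.1 hl.2) (not_le.2 hlK)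

/-- The elementary chain behind both one-sided audits: along the orbit of `u₀`, lower-homogeneity of `F`
(degree `s`), the displayed bound `F ≤ C·G` on `S`, nonnegativity of `G` and upper-homogeneity of `G`
(degree `r`) give `λ^{s-r} ≤ C·G(u₀)/F(u₀)` for every admissible `λ`. [folklore] -/
private theorem rpow_sub_le_of_chain {δ : ℝ → X → X} {S : Set X} {P : ℝ → Prop}
    (hP : ∀ l, P l → 0 < l) (hS : ∀ l : ℝ, P l → ∀ u ∈ S, δ l u ∈ S) {F G : X → ℝ} {s r : ℝ}
    (hF : ∀ l : ℝ, P l → ∀ u ∈ S, l ^ s * F u ≤ F (δ l u))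
    (hG : ∀ l : ℝ, P l → ∀ u ∈ S, G (δ l u) ≤ l ^ r * G u) (hG0 : ∀ u ∈ S, 0 ≤ G u)
    {C : ℝ} (hle : ∀ u ∈ S, F u ≤ C * G u) {u₀ : X} (hu₀ : u₀ ∈ S) (hF₀ : 0 < F u₀) :
    ∀ l : ℝ, P l → l ^ (s - r) ≤ C * G u₀ / F u₀ := by
  -- `C > 0`: `0 < F u₀ ≤ C G u₀` with `G u₀ ≥ 0`
  have hC : 0 < C := by
    have h1 : 0 < C * G u₀ := lt_of_lt_of_le hF₀ (hle u₀ hu₀)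
    by_contra hC
    push Not at hC
    exact absurd h1 (not_lt.2 (mul_nonpos_of_nonpos_of_nonneg hC (hG0 u₀ hu₀)))
  intro l hl
  have hl0 : 0 < l := hP l hl
  have hlr : 0 < l ^ r := Real.rpow_pos_of_pos hl0 r
  have chain : l ^ s * F u₀ ≤ C * (l ^ r * G u₀) :=
    calc l ^ s * F u₀ ≤ F (δ l u₀) := hF l hl u₀ hu₀
      _ ≤ C * G (δ l u₀) := hle _ (hS l hl u₀ hu₀)
      _ ≤ C * (l ^ r * G u₀) := mul_le_mul_of_nonneg_left (hG l hl u₀ hu₀) hC.le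
  rw [le_div_iff₀ hF₀, Real.rpow_sub hl0, div_mul_eq_mul_div, div_le_iff₀ hlr]
  calc l ^ s * F u₀ ≤ C * (l ^ r * G u₀) := chain
    _ = C * G u₀ * l ^ r := by ring

/-- **CONCENTRATION AUDIT (exponents along `λ ≥ 1`).** Let `δ_λ`, `λ ≥ 1`, map the class `S` into itself;
let `F` be lower-homogeneous of degree `s` (`λ^s F(u) ≤ F(δ_λ u)`) and `G ≥ 0` upper-homogeneous of degree
`r` (`G(δ_λ u) ≤ λ^r G(u)`) on `S` for `λ ≥ 1`. If `F u ≤ C·G u` for all `u ∈ S` and one `u₀ ∈ S` has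
`F u₀ > 0`, then `s ≤ r`: the small side may not concentrate faster than the large side. (Bounded
domains: `S` = smooth fields supported in a ball `B ⊆ Ω`, `δ_λ u = u(x₀ + λ(· − x₀))`.)
[cite: Tao2007WhyNSHard, supercriticality paragraph (rescaling `u^{(λ)}`)] -/
theorem exponent_le_of_forall_le_of_concentration {δ : ℝ → X → X} {S : Set X}
    (hS : ∀ l : ℝ, 1 ≤ l → ∀ u ∈ S, δ l u ∈ S) {F G : X → ℝ} {s r : ℝ}
    (hF : ∀ l : ℝ, 1 ≤ l → ∀ u ∈ S, l ^ s * F u ≤ F (δ l u))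
    (hG : ∀ l : ℝ, 1 ≤ l → ∀ u ∈ S, G (δ l u) ≤ l ^ r * G u) (hG0 : ∀ u ∈ S, 0 ≤ G u)
    {C : ℝ} (hle : ∀ u ∈ S, F u ≤ C * G u) {u₀ : X} (hu₀ : u₀ ∈ S) (hF₀ : 0 < F u₀) : s ≤ r := by
  have key := rpow_sub_le_of_chain (P := fun l => 1 ≤ l) (fun l hl => lt_of_lt_of_le one_pos hl)
    hS hF hG hG0 hle hu₀ hF₀
  have := nonpos_of_forall_one_le_rpow_le key
  linarith

/-- **CONCENTRATION AUDIT, refutation form.** With `δ, S, F, G` as in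
`exponent_le_of_forall_le_of_concentration` and `r < s` (the large side concentrates STRICTLY slower than
the small side), NO constant `C` makes `F u ≤ C·G u` hold on `S` (given one `u₀ ∈ S` with `F u₀ > 0`).
Kill route 2 of cell `ns-claims` on bounded domains / support-constrained classes.
[cite: Tao2007WhyNSHard, supercriticality paragraph (rescaling `u^{(λ)}`)] -/
theorem not_exists_forall_le_of_concentration {δ : ℝ → X → X} {S : Set X}
    (hS : ∀ l : ℝ, 1 ≤ l → ∀ u ∈ S, δ l u ∈ S) {F G : X → ℝ} {s r : ℝ}
    (hF : ∀ l : ℝ, 1 ≤ l → ∀ u ∈ S, l ^ s * F u ≤ F (δ l u))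
    (hG : ∀ l : ℝ, 1 ≤ l → ∀ u ∈ S, G (δ l u) ≤ l ^ r * G u) (hG0 : ∀ u ∈ S, 0 ≤ G u) (hrs : r < s)
    {u₀ : X} (hu₀ : u₀ ∈ S) (hF₀ : 0 < F u₀) :
    ¬ ∃ C : ℝ, ∀ u ∈ S, F u ≤ C * G u := by
  rintro ⟨C, hC⟩
  exact absurd (exponent_le_of_forall_le_of_concentration hS hF hG hG0 hC hu₀ hF₀) (not_le.2 hrs)

/-- **SPREADING AUDIT (exponents along `0 < λ ≤ 1`).** Let `δ_λ`, `0 < λ ≤ 1`, map `S` into itself; let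
`F` be lower-homogeneous of degree `s` and `G ≥ 0` upper-homogeneous of degree `r` on `S` along
`0 < λ ≤ 1`. If `F u ≤ C·G u` on `S` and some `u₀ ∈ S` has `F u₀ > 0`, then `r ≤ s` (spreading
`λ → 0⁺`: whole-space classes without a Poincaré constant, displays trading derivatives downwards).
[cite: Tao2007WhyNSHard, supercriticality paragraph (rescaling `u^{(λ)}`)] -/
theorem exponent_le_of_forall_le_of_spreading {δ : ℝ → X → X} {S : Set X}
    (hS : ∀ l : ℝ, 0 < l ∧ l ≤ 1 → ∀ u ∈ S, δ l u ∈ S) {F G : X → ℝ} {s r : ℝ}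
    (hF : ∀ l : ℝ, 0 < l ∧ l ≤ 1 → ∀ u ∈ S, l ^ s * F u ≤ F (δ l u))
    (hG : ∀ l : ℝ, 0 < l ∧ l ≤ 1 → ∀ u ∈ S, G (δ l u) ≤ l ^ r * G u) (hG0 : ∀ u ∈ S, 0 ≤ G u)
    {C : ℝ} (hle : ∀ u ∈ S, F u ≤ C * G u) {u₀ : X} (hu₀ : u₀ ∈ S) (hF₀ : 0 < F u₀) : r ≤ s := by
  have key := rpow_sub_le_of_chain (P := fun l => 0 < l ∧ l ≤ 1) (fun l hl => hl.1)
    hS hF hG hG0 hle hu₀ hF₀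
  have := nonneg_of_forall_le_one_rpow_le (fun l hl0 hl1 => key l ⟨hl0, hl1⟩)
  linarith

/-- **SPREADING AUDIT, refutation form.** With `δ, S, F, G` as in `exponent_le_of_forall_le_of_spreading`
and `s < r`, NO constant `C` makes `F u ≤ C·G u` hold on `S` (given one `u₀ ∈ S` with `F u₀ > 0`).
[cite: Tao2007WhyNSHard, supercriticality paragraph (rescaling `u^{(λ)}`)] -/
theorem not_exists_forall_le_of_spreading {δ : ℝ → X → X} {S : Set X}
    (hS : ∀ l : ℝ, 0 < l ∧ l ≤ 1 → ∀ u ∈ S, δ l u ∈ S) {F G : X → ℝ} {s r : ℝ}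
    (hF : ∀ l : ℝ, 0 < l ∧ l ≤ 1 → ∀ u ∈ S, l ^ s * F u ≤ F (δ l u))
    (hG : ∀ l : ℝ, 0 < l ∧ l ≤ 1 → ∀ u ∈ S, G (δ l u) ≤ l ^ r * G u) (hG0 : ∀ u ∈ S, 0 ≤ G u)
    (hsr : s < r) {u₀ : X} (hu₀ : u₀ ∈ S) (hF₀ : 0 < F u₀) :
    ¬ ∃ C : ℝ, ∀ u ∈ S, F u ≤ C * G u := by
  rintro ⟨C, hC⟩
  exact absurd (exponent_le_of_forall_le_of_spreading hS hF hG hG0 hC hu₀ hF₀) (not_le.2 hsr)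

/-! #### Calculus of upper-homogeneous nonnegative functionals (for assembling the large side `G`) -/

/-- **Products**: if `G₁, G₂ ≥ 0` on `S` are upper-homogeneous of degrees `r₁, r₂` along the admissible
scales `P`, so is `G₁·G₂`, of degree `r₁ + r₂`. [cite: Tao2007WhyNSHard, supercriticality paragraph (rescaling `u^{(λ)}`)] -/
theorem upperHomogeneous_mul {δ : ℝ → X → X} {S : Set X} {P : ℝ → Prop} (hP : ∀ l, P l → 0 < l)
    {G₁ G₂ : X → ℝ} {r₁ r₂ : ℝ} (hG₁ : ∀ l : ℝ, P l → ∀ u ∈ S, G₁ (δ l u) ≤ l ^ r₁ * G₁ u)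
    (hG₂ : ∀ l : ℝ, P l → ∀ u ∈ S, G₂ (δ l u) ≤ l ^ r₂ * G₂ u) (h₁ : ∀ u ∈ S, 0 ≤ G₁ u)
    (h₂ : ∀ u ∈ S, 0 ≤ G₂ u) (hS : ∀ l : ℝ, P l → ∀ u ∈ S, δ l u ∈ S) :
    ∀ l : ℝ, P l → ∀ u ∈ S, G₁ (δ l u) * G₂ (δ l u) ≤ l ^ (r₁ + r₂) * (G₁ u * G₂ u) := by
  intro l hl u hu
  have hl0 : 0 < l := hP l hl
  calc G₁ (δ l u) * G₂ (δ l u) ≤ (l ^ r₁ * G₁ u) * (l ^ r₂ * G₂ u) :=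
        mul_le_mul (hG₁ l hl u hu) (hG₂ l hl u hu) (h₂ _ (hS l hl u hu))
          (mul_nonneg (Real.rpow_nonneg hl0.le _) (h₁ u hu))
    _ = l ^ (r₁ + r₂) * (G₁ u * G₂ u) := by rw [Real.rpow_add hl0]; ring

/-- **Nonnegative powers**: if `G ≥ 0` on `S` is upper-homogeneous of degree `r` along `P`, then `G^a`
(`a ≥ 0`, real power) is upper-homogeneous of degree `a·r`. [cite: Tao2007WhyNSHard, supercriticality paragraph (rescaling `u^{(λ)}`)] -/
theorem upperHomogeneous_rpow {δ : ℝ → X → X} {S : Set X} {P : ℝ → Prop} (hP : ∀ l, P l → 0 < l)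
    {G : X → ℝ} {r a : ℝ} (hG : ∀ l : ℝ, P l → ∀ u ∈ S, G (δ l u) ≤ l ^ r * G u)
    (h0 : ∀ u ∈ S, 0 ≤ G u) (ha : 0 ≤ a) (hS : ∀ l : ℝ, P l → ∀ u ∈ S, δ l u ∈ S) :
    ∀ l : ℝ, P l → ∀ u ∈ S, G (δ l u) ^ a ≤ l ^ (a * r) * G u ^ a := by
  intro l hl u hu
  have hl0 : 0 < l := hP l hl
  calc G (δ l u) ^ a ≤ (l ^ r * G u) ^ a :=
        Real.rpow_le_rpow (h0 _ (hS l hl u hu)) (hG l hl u hu) ha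
    _ = l ^ (a * r) * G u ^ a := by
        rw [Real.mul_rpow (Real.rpow_nonneg hl0.le _) (h0 u hu), ← Real.rpow_mul hl0.le, mul_comm r a]

/-- **Sums under concentration** (`λ ≥ 1`): if `G₁, G₂ ≥ 0` are upper-homogeneous of degrees `r₁, r₂`
along `λ ≥ 1`, then `G₁ + G₂` is upper-homogeneous of degree `max r₁ r₂` — the rule for inhomogeneous
norms `‖u‖² + ‖∇u‖² + …` under concentrating bumps. [cite: Tao2007WhyNSHard, supercriticality paragraph (rescaling `u^{(λ)}`)] -/
theorem upperHomogeneous_add_of_one_le {δ : ℝ → X → X} {S : Set X} {G₁ G₂ : X → ℝ} {r₁ r₂ : ℝ}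
    (hG₁ : ∀ l : ℝ, 1 ≤ l → ∀ u ∈ S, G₁ (δ l u) ≤ l ^ r₁ * G₁ u)
    (hG₂ : ∀ l : ℝ, 1 ≤ l → ∀ u ∈ S, G₂ (δ l u) ≤ l ^ r₂ * G₂ u) (h₁ : ∀ u ∈ S, 0 ≤ G₁ u)
    (h₂ : ∀ u ∈ S, 0 ≤ G₂ u) :
    ∀ l : ℝ, 1 ≤ l → ∀ u ∈ S, G₁ (δ l u) + G₂ (δ l u) ≤ l ^ (max r₁ r₂) * (G₁ u + G₂ u) := by
  intro l hl u hu
  have e₁ : l ^ r₁ ≤ l ^ (max r₁ r₂) := Real.rpow_le_rpow_of_exponent_le hl (le_max_left _ _)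
  have e₂ : l ^ r₂ ≤ l ^ (max r₁ r₂) := Real.rpow_le_rpow_of_exponent_le hl (le_max_right _ _)
  calc G₁ (δ l u) + G₂ (δ l u) ≤ l ^ r₁ * G₁ u + l ^ r₂ * G₂ u := add_le_add (hG₁ l hl u hu) (hG₂ l hl u hu)
    _ ≤ l ^ (max r₁ r₂) * G₁ u + l ^ (max r₁ r₂) * G₂ u :=
        add_le_add (mul_le_mul_of_nonneg_right e₁ (h₁ u hu)) (mul_le_mul_of_nonneg_right e₂ (h₂ u hu))
    _ = l ^ (max r₁ r₂) * (G₁ u + G₂ u) := by ring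

/-- **Sums under spreading** (`0 < λ ≤ 1`): degrees combine by `min`. [cite: Tao2007WhyNSHard, supercriticality paragraph (rescaling `u^{(λ)}`)] -/
theorem upperHomogeneous_add_of_le_one {δ : ℝ → X → X} {S : Set X} {G₁ G₂ : X → ℝ} {r₁ r₂ : ℝ}
    (hG₁ : ∀ l : ℝ, 0 < l ∧ l ≤ 1 → ∀ u ∈ S, G₁ (δ l u) ≤ l ^ r₁ * G₁ u)
    (hG₂ : ∀ l : ℝ, 0 < l ∧ l ≤ 1 → ∀ u ∈ S, G₂ (δ l u) ≤ l ^ r₂ * G₂ u) (h₁ : ∀ u ∈ S, 0 ≤ G₁ u)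
    (h₂ : ∀ u ∈ S, 0 ≤ G₂ u) :
    ∀ l : ℝ, 0 < l ∧ l ≤ 1 → ∀ u ∈ S, G₁ (δ l u) + G₂ (δ l u) ≤ l ^ (min r₁ r₂) * (G₁ u + G₂ u) := by
  intro l hl u hu
  have e₁ : l ^ r₁ ≤ l ^ (min r₁ r₂) := Real.rpow_le_rpow_of_exponent_ge hl.1 hl.2 (min_le_left _ _)
  have e₂ : l ^ r₂ ≤ l ^ (min r₁ r₂) := Real.rpow_le_rpow_of_exponent_ge hl.1 hl.2 (min_le_right _ _)
  calc G₁ (δ l u) + G₂ (δ l u) ≤ l ^ r₁ * G₁ u + l ^ r₂ * G₂ u := add_le_add (hG₁ l hl u hu) (hG₂ l hl u hu)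
    _ ≤ l ^ (min r₁ r₂) * G₁ u + l ^ (min r₁ r₂) * G₂ u :=
        add_le_add (mul_le_mul_of_nonneg_right e₁ (h₁ u hu)) (mul_le_mul_of_nonneg_right e₂ (h₂ u hu))
    _ = l ^ (min r₁ r₂) * (G₁ u + G₂ u) := by ring

/-- An exactly homogeneous functional is in particular lower- and upper-homogeneous (bridge from the
two-sided audit's hypotheses to the one-sided ones). [cite: Tao2007WhyNSHard, supercriticality paragraph (rescaling `u^{(λ)}`)] -/
theorem lower_and_upper_of_homogeneous {δ : ℝ → X → X} {S : Set X} {P : ℝ → Prop} {F : X → ℝ} {s : ℝ}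
    (hF : ∀ l : ℝ, P l → ∀ u ∈ S, F (δ l u) = l ^ s * F u) :
    (∀ l : ℝ, P l → ∀ u ∈ S, l ^ s * F u ≤ F (δ l u)) ∧
      (∀ l : ℝ, P l → ∀ u ∈ S, F (δ l u) ≤ l ^ s * F u) :=
  ⟨fun l hl u hu => (hF l hl u hu).ge, fun l hl u hu => (hF l hl u hu).le⟩

/-- **Products of powers of upper-homogeneous functionals** (general admissible scales `P`): if
`G₁, G₂ ≥ 0` on `S` are upper-homogeneous of degrees `r₁, r₂` and `a, b ≥ 0`, then `G₁^a·G₂^b` is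
upper-homogeneous of degree `a r₁ + b r₂`. [cite: Tao2007WhyNSHard, supercriticality paragraph (rescaling `u^{(λ)}`)] -/
theorem upperHomogeneous_rpow_mul_rpow {δ : ℝ → X → X} {S : Set X} {P : ℝ → Prop} (hP : ∀ l, P l → 0 < l)
    (hS : ∀ l : ℝ, P l → ∀ u ∈ S, δ l u ∈ S) {G₁ G₂ : X → ℝ} {r₁ r₂ a b : ℝ}
    (hG₁ : ∀ l : ℝ, P l → ∀ u ∈ S, G₁ (δ l u) ≤ l ^ r₁ * G₁ u)
    (hG₂ : ∀ l : ℝ, P l → ∀ u ∈ S, G₂ (δ l u) ≤ l ^ r₂ * G₂ u) (h₁ : ∀ u ∈ S, 0 ≤ G₁ u)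
    (h₂ : ∀ u ∈ S, 0 ≤ G₂ u) (ha : 0 ≤ a) (hb : 0 ≤ b) :
    ∀ l : ℝ, P l → ∀ u ∈ S,
      G₁ (δ l u) ^ a * G₂ (δ l u) ^ b ≤ l ^ (a * r₁ + b * r₂) * (G₁ u ^ a * G₂ u ^ b) := by
  intro l hl u hu
  have hl0 : 0 < l := hP l hl
  have e₁ := upperHomogeneous_rpow hP hG₁ h₁ ha hS l hl u hu
  have e₂ := upperHomogeneous_rpow hP hG₂ h₂ hb hS l hl u hu
  calc G₁ (δ l u) ^ a * G₂ (δ l u) ^ b ≤ (l ^ (a * r₁) * G₁ u ^ a) * (l ^ (b * r₂) * G₂ u ^ b) :=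
        mul_le_mul e₁ e₂ (Real.rpow_nonneg (h₂ _ (hS l hl u hu)) _)
          (mul_nonneg (Real.rpow_nonneg hl0.le _) (Real.rpow_nonneg (h₁ u hu) _))
    _ = l ^ (a * r₁ + b * r₂) * (G₁ u ^ a * G₂ u ^ b) := by rw [Real.rpow_add hl0]; ring

/-- **CONCENTRATION AUDIT for interpolation-type displays `F ≤ C·G₁^a·G₂^b` on a bounded domain /
support-constrained class** (`λ ≥ 1` only): if `F` is lower-homogeneous of degree `s`, `G₁, G₂ ≥ 0` are
upper-homogeneous of degrees `r₁, r₂`, `a, b ≥ 0` and `a r₁ + b r₂ < s`, then no constant `C` makes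
`F u ≤ C·G₁(u)^a·G₂(u)^b` hold on `S` (given one `u₀ ∈ S` with `F u₀ > 0`). E.g. (C128, Lemme 3.4 (9),
squared): `F = ‖(u·∇)u‖²` (`s = −1`), `G₁ = ‖u‖²_{H¹}·‖u‖_{L²}` (`r₁ = −1 − 3/2`), `G₂ = ‖u‖²_{H²}`
(`r₂ = 1`), `a = 1`, `b = 1/2`: `−5/2 + 1/2 = −2 < −1`.
[cite: Tao2007WhyNSHard, supercriticality paragraph (rescaling `u^{(λ)}`)] -/
theorem not_exists_forall_le_rpow_mul_rpow_of_concentration {δ : ℝ → X → X} {S : Set X}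
    (hS : ∀ l : ℝ, 1 ≤ l → ∀ u ∈ S, δ l u ∈ S) {F G₁ G₂ : X → ℝ} {s r₁ r₂ a b : ℝ}
    (hF : ∀ l : ℝ, 1 ≤ l → ∀ u ∈ S, l ^ s * F u ≤ F (δ l u))
    (hG₁ : ∀ l : ℝ, 1 ≤ l → ∀ u ∈ S, G₁ (δ l u) ≤ l ^ r₁ * G₁ u)
    (hG₂ : ∀ l : ℝ, 1 ≤ l → ∀ u ∈ S, G₂ (δ l u) ≤ l ^ r₂ * G₂ u)
    (h₁ : ∀ u ∈ S, 0 ≤ G₁ u) (h₂ : ∀ u ∈ S, 0 ≤ G₂ u) (ha : 0 ≤ a) (hb : 0 ≤ b)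
    (hlt : a * r₁ + b * r₂ < s) {u₀ : X} (hu₀ : u₀ ∈ S) (hF₀ : 0 < F u₀) :
    ¬ ∃ C : ℝ, ∀ u ∈ S, F u ≤ C * (G₁ u ^ a * G₂ u ^ b) :=
  not_exists_forall_le_of_concentration (G := fun u => G₁ u ^ a * G₂ u ^ b) hS hF
    (upperHomogeneous_rpow_mul_rpow (P := fun l => 1 ≤ l) (fun _ hl => lt_of_lt_of_le one_pos hl) hS hG₁ hG₂
      h₁ h₂ ha hb)
    (fun u hu => mul_nonneg (Real.rpow_nonneg (h₁ u hu) _) (Real.rpow_nonneg (h₂ u hu) _)) hlt hu₀ hF₀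

/-- **SPREADING AUDIT for interpolation-type displays** (`0 < λ ≤ 1` only): with the same data along
`0 < λ ≤ 1` and `s < a r₁ + b r₂`, no constant `C` makes `F u ≤ C·G₁(u)^a·G₂(u)^b` hold on `S`.
[cite: Tao2007WhyNSHard, supercriticality paragraph (rescaling `u^{(λ)}`)] -/
theorem not_exists_forall_le_rpow_mul_rpow_of_spreading {δ : ℝ → X → X} {S : Set X}
    (hS : ∀ l : ℝ, 0 < l ∧ l ≤ 1 → ∀ u ∈ S, δ l u ∈ S) {F G₁ G₂ : X → ℝ} {s r₁ r₂ a b : ℝ}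
    (hF : ∀ l : ℝ, 0 < l ∧ l ≤ 1 → ∀ u ∈ S, l ^ s * F u ≤ F (δ l u))
    (hG₁ : ∀ l : ℝ, 0 < l ∧ l ≤ 1 → ∀ u ∈ S, G₁ (δ l u) ≤ l ^ r₁ * G₁ u)
    (hG₂ : ∀ l : ℝ, 0 < l ∧ l ≤ 1 → ∀ u ∈ S, G₂ (δ l u) ≤ l ^ r₂ * G₂ u)
    (h₁ : ∀ u ∈ S, 0 ≤ G₁ u) (h₂ : ∀ u ∈ S, 0 ≤ G₂ u) (ha : 0 ≤ a) (hb : 0 ≤ b)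
    (hlt : s < a * r₁ + b * r₂) {u₀ : X} (hu₀ : u₀ ∈ S) (hF₀ : 0 < F u₀) :
    ¬ ∃ C : ℝ, ∀ u ∈ S, F u ≤ C * (G₁ u ^ a * G₂ u ^ b) :=
  not_exists_forall_le_of_spreading (G := fun u => G₁ u ^ a * G₂ u ^ b) hS hF
    (upperHomogeneous_rpow_mul_rpow (P := fun l => 0 < l ∧ l ≤ 1) (fun _ hl => hl.1) hS hG₁ hG₂
      h₁ h₂ ha hb)
    (fun u hu => mul_nonneg (Real.rpow_nonneg (h₁ u hu) _) (Real.rpow_nonneg (h₂ u hu) _)) hlt hu₀ hF₀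

end ScalingAudit

end Literature.Barriers.NavierStokesRegularity

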